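import Summits.AtomisticToContinuum.FouriersLaw.Theorems.LocalOhmBVLocalOhmStubGibbsTermCovarianceDecayAux1
import Mathlib.MeasureTheory.Function.L2Space

/-!
# Per-term covariance decay for the free finite Gibbs state (stub `stub_gibbsTermCovarianceDecay`),
# helper II: block splitting of product-measure integrals and the `L²` bound of the left vector

Helper file for crux item stmt-AtomisticToContinuum-12009 (`LocalOhmBV.LocalOhm`, line `registered`,
stub T2 `stub_gibbsTermCovarianceDecay`); continuation of `…GibbsTermCovarianceDecayAux1` (the weight
`w N ζ` of the `N`-site chain relative to the product a priori measure `ρ^{⊗N}` and its gluing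
identities). Measure theory on `Ω_N = Fin N → Y` with `π_N = ρ^{⊗N}` (`ρ` σ-finite):

* `exists_measurableEquiv_append`, `integral_pi_add_eq_integral_prod`, `integrable_comp_append_iff` —
  `Ω_{l+m} ≃ Ω_l × Ω_m` along `Fin.append` is measure preserving (Mathlib's `sumPiEquivProdPi` and
  `piCongrLeft finSumFinEquiv`);
* `exists_measurableEquiv_snoc`, `integral_mul_last_eq_integral_snoc`, `lintegral_pi_succ_eq_snoc` —
  `Ω_{e+1} ≃ Y × Ω_e` along `Fin.snoc` (Mathlib's `piFinSuccAbove` at `Fin.last`), i.e. freezing the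
  last site;
* `integral_mul_w_split` — **block split** of a Gibbs-type integral `∫ F w_{e+1+m} dπ` for an
  observable `F(append ξ η) = Gl(ξ) Fr(ξ_e, η)`: the right block is integrated out into a function
  `R` of the boundary spin `ξ_e` (in the `Fin.cons` form of `SpecificHeatLimit.hetPath_spec`);
* `memLp_leftVector` — **the left vector is square integrable**: freezing the last site `x` of the
  left block and integrating out the others defines `Ĝ(x)`; by Cauchy–Schwarz and
  `leftWeight_snoc_le`, `∫ Ĝ² dρ ≤ Z_e · ∫ Gl² w_{e+1} dπ_{e+1}` with `Z_e = ∫ w_e dπ_e` — a product of two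
  un-normalised Gibbs integrals of SHORTER chains (no transfer-operator input).

All [folklore]; no definitions (every object enters through a defining hypothesis).
-/

set_option autoImplicit false

noncomputable section

namespace Summit.AtomisticToContinuum.FouriersLaw.Theorems.LocalOhmBirth.TermDecay

open MeasureTheory Filter Topology Function
open scoped BigOperators ENNReal

variable {Y : Type*} [MeasurableSpace Y] (ρ : Measure Y)

/-! ### Gluing two blocks: `Ω_{l+m} ≃ Ω_l × Ω_m` -/

/-- **`Fin.append` is a measure-preserving equivalence** `Ω_l × Ω_m ≃ Ω_{l+m}` for the product
measures `ρ^{⊗l} ⊗ ρ^{⊗m}` and `ρ^{⊗(l+m)}`. -/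
theorem exists_measurableEquiv_append [SigmaFinite ρ] (l m : ℕ) :
    ∃ e : (Fin l → Y) × (Fin m → Y) ≃ᵐ (Fin (l + m) → Y),
      (∀ p, e p = Fin.append p.1 p.2) ∧
      MeasurePreserving e ((Measure.pi fun _ : Fin l => ρ).prod (Measure.pi fun _ : Fin m => ρ))
        (Measure.pi fun _ : Fin (l + m) => ρ) := by
  set e₁ := MeasurableEquiv.piCongrLeft (fun _ : Fin (l + m) => Y) finSumFinEquiv with he₁
  set e₂ := MeasurableEquiv.sumPiEquivProdPi (fun _ : Fin l ⊕ Fin m => Y) with he₂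
  refine ⟨e₂.symm.trans e₁, fun p => ?_, ?_⟩
  · funext i
    rw [MeasurableEquiv.trans_apply]
    refine Fin.addCases (fun i' => ?_) (fun j' => ?_) i
    · rw [Fin.append_left, ← finSumFinEquiv_apply_left (n := m) i', he₁,
        MeasurableEquiv.piCongrLeft_apply_apply]
      rw [he₂, MeasurableEquiv.coe_sumPiEquivProdPi_symm]
      rfl
    · rw [Fin.append_right, ← finSumFinEquiv_apply_right (m := l) j', he₁,
        MeasurableEquiv.piCongrLeft_apply_apply]
      rw [he₂, MeasurableEquiv.coe_sumPiEquivProdPi_symm]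
      rfl
  · exact (measurePreserving_piCongrLeft (fun _ : Fin (l + m) => ρ) finSumFinEquiv).comp
      (measurePreserving_sumPiEquivProdPi_symm (fun _ : Fin l ⊕ Fin m => ρ))

/-- Integrals over `Ω_{l+m}` as integrals over `Ω_l × Ω_m` along `Fin.append`. -/
theorem integral_pi_add_eq_integral_prod [SigmaFinite ρ] (l m : ℕ) (F : (Fin (l + m) → Y) → ℝ) :
    ∫ ζ, F ζ ∂(Measure.pi fun _ : Fin (l + m) => ρ) =
      ∫ p, F (Fin.append p.1 p.2)
        ∂((Measure.pi fun _ : Fin l => ρ).prod (Measure.pi fun _ : Fin m => ρ)) := by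
  obtain ⟨e, he, hmp⟩ := exists_measurableEquiv_append ρ l m
  rw [← hmp.integral_comp']
  exact integral_congr_ae (ae_of_all _ fun p => by simp only [he])

/-- Integrability over `Ω_{l+m}` versus `Ω_l × Ω_m`. -/
theorem integrable_comp_append_iff [SigmaFinite ρ] (l m : ℕ) (F : (Fin (l + m) → Y) → ℝ) :
    Integrable (fun p : (Fin l → Y) × (Fin m → Y) => F (Fin.append p.1 p.2))
        ((Measure.pi fun _ : Fin l => ρ).prod (Measure.pi fun _ : Fin m => ρ)) ↔
      Integrable F (Measure.pi fun _ : Fin (l + m) => ρ) := by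
  obtain ⟨e, he, hmp⟩ := exists_measurableEquiv_append ρ l m
  have h : (fun p : (Fin l → Y) × (Fin m → Y) => F (Fin.append p.1 p.2)) = F ∘ e :=
    funext fun p => by rw [Function.comp_apply, he]
  rw [h]
  exact hmp.integrable_comp_emb e.measurableEmbedding

/-! ### Freezing the last site: `Ω_{e+1} ≃ Y × Ω_e` -/

/-- **`Fin.snoc` is a measure-preserving equivalence** `Y × Ω_e ≃ Ω_{e+1}` (the frozen last site
first) for `ρ ⊗ ρ^{⊗e}` and `ρ^{⊗(e+1)}`. -/
theorem exists_measurableEquiv_snoc [SigmaFinite ρ] (e : ℕ) :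
    ∃ E : Y × (Fin e → Y) ≃ᵐ (Fin (e + 1) → Y),
      (∀ p, E p = (Fin.snoc p.2 p.1 : Fin (e + 1) → Y)) ∧
      MeasurePreserving E (ρ.prod (Measure.pi fun _ : Fin e => ρ)) (Measure.pi fun _ : Fin (e + 1) => ρ) := by
  refine ⟨(MeasurableEquiv.piFinSuccAbove (fun _ : Fin (e + 1) => Y) (Fin.last e)).symm, fun p => ?_, ?_⟩
  · rw [MeasurableEquiv.piFinSuccAbove_symm_apply]
    change Fin.insertNth (Fin.last e) p.1 p.2 = (Fin.snoc p.2 p.1 : Fin (e + 1) → Y)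
    exact Fin.insertNth_last' p.1 p.2
  · exact (measurePreserving_piFinSuccAbove (fun _ : Fin (e + 1) => ρ) (Fin.last e)).symm

/-- Measurability of `(x, ξ') ↦ ξ' ∷ʳ x`. -/
theorem measurable_snoc (e : ℕ) :
    Measurable fun p : Y × (Fin e → Y) => (Fin.snoc p.2 p.1 : Fin (e + 1) → Y) := by
  refine measurable_pi_iff.2 (Fin.lastCases ?_ (fun j => ?_))
  · simp only [Fin.snoc_last]
    exact measurable_fst
  · simp only [Fin.snoc_castSucc]
    exact (measurable_pi_apply j).comp measurable_snd

/-- **Freezing the last site in an integral**: for an integrand `Φ(ξ) h(ξ_e)`,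
`∫ Φ(ξ) h(ξ_e) dπ_{e+1}(ξ) = ∫ (∫ Φ(ξ' ∷ʳ x) dπ_e(ξ')) h(x) dρ(x)`. -/
theorem integral_mul_last_eq_integral_snoc [SigmaFinite ρ] (e : ℕ) {Φ : (Fin (e + 1) → Y) → ℝ}
    {h : Y → ℝ}
    (hint : Integrable (fun ξ => Φ ξ * h (ξ (Fin.last e))) (Measure.pi fun _ : Fin (e + 1) => ρ)) :
    ∫ ξ, Φ ξ * h (ξ (Fin.last e)) ∂(Measure.pi fun _ : Fin (e + 1) => ρ) =
      ∫ x, (∫ ξ', Φ (Fin.snoc ξ' x) ∂(Measure.pi fun _ : Fin e => ρ)) * h x ∂ρ := by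
  obtain ⟨E, hE, hmp⟩ := exists_measurableEquiv_snoc ρ e
  have h1 : ∫ ξ, Φ ξ * h (ξ (Fin.last e)) ∂(Measure.pi fun _ : Fin (e + 1) => ρ) =
      ∫ p, Φ (Fin.snoc p.2 p.1 : Fin (e + 1) → Y) * h p.1 ∂(ρ.prod (Measure.pi fun _ : Fin e => ρ)) := by
    rw [← hmp.integral_comp']
    refine integral_congr_ae (ae_of_all _ fun p => ?_)
    dsimp only
    rw [hE, Fin.snoc_last]
  have h2 : Integrable (fun p : Y × (Fin e → Y) => Φ (Fin.snoc p.2 p.1 : Fin (e + 1) → Y) * h p.1)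
      (ρ.prod (Measure.pi fun _ : Fin e => ρ)) := by
    have : (fun p : Y × (Fin e → Y) => Φ (Fin.snoc p.2 p.1 : Fin (e + 1) → Y) * h p.1) =
        (fun ξ => Φ ξ * h (ξ (Fin.last e))) ∘ E := by
      funext p
      rw [Function.comp_apply, hE, Fin.snoc_last]
    rw [this]
    exact (hmp.integrable_comp_emb E.measurableEmbedding).2 hint
  rw [h1, integral_prod _ h2]
  refine integral_congr_ae (ae_of_all _ fun x => ?_)
  dsimp only
  rw [integral_mul_const]

/-- **Freezing the last site in a lower Lebesgue integral** (Tonelli): for measurable `F`,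
`∫⁻ F dπ_{e+1} = ∫⁻ (∫⁻ F(ξ' ∷ʳ x) dπ_e(ξ')) dρ(x)`. -/
theorem lintegral_pi_succ_eq_snoc [SigmaFinite ρ] (e : ℕ) {F : (Fin (e + 1) → Y) → ℝ≥0∞}
    (hF : Measurable F) :
    ∫⁻ ξ, F ξ ∂(Measure.pi fun _ : Fin (e + 1) => ρ) =
      ∫⁻ x, ∫⁻ ξ', F (Fin.snoc ξ' x) ∂(Measure.pi fun _ : Fin e => ρ) ∂ρ := by
  obtain ⟨E, hE, hmp⟩ := exists_measurableEquiv_snoc ρ e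
  rw [← hmp.lintegral_comp hF]
  have h1 : (fun p : Y × (Fin e → Y) => F (E p)) = fun p => F (Fin.snoc p.2 p.1 : Fin (e + 1) → Y) :=
    funext fun p => by rw [hE]
  rw [h1]
  exact lintegral_prod (fun p : Y × (Fin e → Y) => F (Fin.snoc p.2 p.1 : Fin (e + 1) → Y))
    (hF.comp (measurable_snoc e)).aemeasurable

/-! ### Block split of Gibbs-type integrals -/

section Weight

variable {a : Y → ℝ} {K₀ k : Y → Y → ℝ} {w : (N : ℕ) → (Fin N → Y) → ℝ}

/-- **Block split.** Let `F` be an observable of the `(e+1+m)`-site chain of the product form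
`F(append ξ η) = Gl(ξ) · Fr(ξ_e, η)` (a left observable times a right observable which may also read
the last LEFT site `ξ_e`, the boundary spin), with `F w` integrable. Then
`∫ F w_{e+1+m} dπ = ∫ Gl(ξ) L(ξ) R(ξ_e) dπ_{e+1}(ξ)` where `L(ξ) = a(ξ₀) ∏_{i<e} k(ξᵢ, ξᵢ₊₁)` is the
left weight and `R(u) = ∫ Fr(u, η) (∏_{j<m} k((u∷η)ⱼ, ηⱼ)) a((u∷η)_m) dπ_m(η)` the right block
integrated out (a heterogeneous path functional of the boundary spin), and the new integrand is
integrable. -/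
theorem integral_mul_w_split [SigmaFinite ρ] (hk : ∀ x y, k x y = a x * K₀ x y * a y)
    (hw : ∀ (N : ℕ) (ζ : Fin N → Y), w N ζ = (∏ i, a (ζ i) ^ 2) *
      ∏ i : Fin N, ∏ j : Fin N, if j.val = i.val + 1 then K₀ (ζ i) (ζ j) else 1)
    (e m : ℕ) {F : (Fin (e + 1 + m) → Y) → ℝ} {Gl : (Fin (e + 1) → Y) → ℝ} {Fr : Y → (Fin m → Y) → ℝ}
    (hF : ∀ ξ η, F (Fin.append ξ η) = Gl ξ * Fr (ξ (Fin.last e)) η)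
    (hFi : Integrable (fun ζ => F ζ * w (e + 1 + m) ζ) (Measure.pi fun _ : Fin (e + 1 + m) => ρ))
    {R : Y → ℝ}
    (hR : ∀ u, R u = ∫ η, Fr u η * ((∏ i : Fin m, k ((Fin.cons u η : Fin (m + 1) → Y) (Fin.castSucc i)) (η i)) *
      a ((Fin.cons u η : Fin (m + 1) → Y) (Fin.last m))) ∂(Measure.pi fun _ : Fin m => ρ)) :
    ∫ ζ, F ζ * w (e + 1 + m) ζ ∂(Measure.pi fun _ : Fin (e + 1 + m) => ρ) =
      ∫ ξ, Gl ξ * (a (ξ 0) * ∏ i : Fin e, k (ξ (Fin.castSucc i)) (ξ i.succ)) * R (ξ (Fin.last e))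
        ∂(Measure.pi fun _ : Fin (e + 1) => ρ) ∧
    Integrable (fun ξ => Gl ξ * (a (ξ 0) * ∏ i : Fin e, k (ξ (Fin.castSucc i)) (ξ i.succ)) * R (ξ (Fin.last e)))
      (Measure.pi fun _ : Fin (e + 1) => ρ) := by
  set f : (Fin (e + 1) → Y) × (Fin m → Y) → ℝ := fun p =>
    F (Fin.append p.1 p.2) * w (e + 1 + m) (Fin.append p.1 p.2) with hfdef
  have hfi : Integrable f ((Measure.pi fun _ : Fin (e + 1) => ρ).prod (Measure.pi fun _ : Fin m => ρ)) :=
    (integrable_comp_append_iff ρ (e + 1) m (fun ζ => F ζ * w (e + 1 + m) ζ)).2 hFi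
  have hf : ∀ ξ η, f (ξ, η) = (Gl ξ * (a (ξ 0) * ∏ i : Fin e, k (ξ (Fin.castSucc i)) (ξ i.succ))) *
      (Fr (ξ (Fin.last e)) η * ((∏ i : Fin m, k ((Fin.cons (ξ (Fin.last e)) η : Fin (m + 1) → Y)
        (Fin.castSucc i)) (η i)) * a ((Fin.cons (ξ (Fin.last e)) η : Fin (m + 1) → Y) (Fin.last m)))) := by
    intro ξ η
    rw [hfdef]
    dsimp only
    rw [hF, w_append_succ hk hw]
    ring
  have hinner : ∀ ξ, ∫ η, f (ξ, η) ∂(Measure.pi fun _ : Fin m => ρ) =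
      Gl ξ * (a (ξ 0) * ∏ i : Fin e, k (ξ (Fin.castSucc i)) (ξ i.succ)) * R (ξ (Fin.last e)) := by
    intro ξ
    rw [show (fun η => f (ξ, η)) = fun η => (Gl ξ * (a (ξ 0) * ∏ i : Fin e, k (ξ (Fin.castSucc i)) (ξ i.succ))) *
      (Fr (ξ (Fin.last e)) η * ((∏ i : Fin m, k ((Fin.cons (ξ (Fin.last e)) η : Fin (m + 1) → Y)
        (Fin.castSucc i)) (η i)) * a ((Fin.cons (ξ (Fin.last e)) η : Fin (m + 1) → Y) (Fin.last m))))
      from funext fun η => hf ξ η, integral_const_mul, hR]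
  have h1 : ∫ ζ, F ζ * w (e + 1 + m) ζ ∂(Measure.pi fun _ : Fin (e + 1 + m) => ρ) =
      ∫ p, f p ∂((Measure.pi fun _ : Fin (e + 1) => ρ).prod (Measure.pi fun _ : Fin m => ρ)) :=
    integral_pi_add_eq_integral_prod ρ (e + 1) m _
  refine ⟨?_, ?_⟩
  · rw [h1, integral_prod _ hfi]
    exact integral_congr_ae (ae_of_all _ fun ξ => hinner ξ)
  · exact hfi.integral_prod_left.congr (ae_of_all _ fun ξ => hinner ξ)

/-- **The left vector is square integrable.** Let `Gl` be a measurable observable of the left block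
(`e+1` sites) with `∫ Gl² w_{e+1} dπ_{e+1} < ∞` and let `w_e` be integrable. Freezing the last site at
`x` and integrating out the others, `Ĝ(x) = ∫ Gl(ξ' ∷ʳ x) L(ξ' ∷ʳ x) dπ_e(ξ')` (`L` the left weight),
defines a function in `L²(ρ)` with `∫ Ĝ² dρ ≤ (∫ w_e dπ_e) · ∫ Gl² w_{e+1} dπ_{e+1}` (Cauchy–Schwarz in
`ξ'` and `L(ξ' ∷ʳ x) ≤ a(x) w_e(ξ')`, `L(ξ) a(ξ_e) = w_{e+1}(ξ)`): both factors are un-normalised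
Gibbs integrals of shorter chains. -/
theorem memLp_leftVector [IsFiniteMeasure ρ] (hk : ∀ x y, k x y = a x * K₀ x y * a y)
    (hw : ∀ (N : ℕ) (ζ : Fin N → Y), w N ζ = (∏ i, a (ζ i) ^ 2) *
      ∏ i : Fin N, ∏ j : Fin N, if j.val = i.val + 1 then K₀ (ζ i) (ζ j) else 1)
    (ha0 : ∀ x, 0 < a x) (hK0 : ∀ x y, 0 ≤ K₀ x y) (hK1 : ∀ x y, K₀ x y ≤ 1)
    (ham : Measurable a) (hkm : Measurable (uncurry k)) (e : ℕ)
    {Gl : (Fin (e + 1) → Y) → ℝ} (hGl : Measurable Gl)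
    (hI : Integrable (fun ξ => Gl ξ ^ 2 * w (e + 1) ξ) (Measure.pi fun _ : Fin (e + 1) => ρ))
    (hZ : Integrable (w e) (Measure.pi fun _ : Fin e => ρ))
    {Ĝ : Y → ℝ}
    (hĜ : ∀ x, Ĝ x = ∫ ξ', Gl (Fin.snoc ξ' x) * (a ((Fin.snoc ξ' x : Fin (e + 1) → Y) 0) *
      ∏ i : Fin e, k ((Fin.snoc ξ' x : Fin (e + 1) → Y) (Fin.castSucc i))
        ((Fin.snoc ξ' x : Fin (e + 1) → Y) i.succ)) ∂(Measure.pi fun _ : Fin e => ρ)) :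
    MemLp Ĝ 2 ρ ∧
      ∫ x, Ĝ x ^ 2 ∂ρ ≤ (∫ ξ', w e ξ' ∂(Measure.pi fun _ : Fin e => ρ)) *
        ∫ ξ, Gl ξ ^ 2 * w (e + 1) ξ ∂(Measure.pi fun _ : Fin (e + 1) => ρ) := by
  set L : (Fin (e + 1) → Y) → ℝ := fun ξ => a (ξ 0) * ∏ i : Fin e, k (ξ (Fin.castSucc i)) (ξ i.succ)
    with hLdef
  have hL0 : ∀ ξ, 0 ≤ L ξ := fun ξ => leftWeight_nonneg hk (fun x => (ha0 x).le) hK0 e ξ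
  have hLm : Measurable L := measurable_leftWeight ham hkm e
  have hLsnoc : ∀ (ξ' : Fin e → Y) (x : Y), L (Fin.snoc ξ' x) ≤ a x * w e ξ' := fun ξ' x =>
    leftWeight_snoc_le hk hw ha0 hK0 hK1 e ξ' x
  have hLa : ∀ ξ, L ξ * a (ξ (Fin.last e)) = w (e + 1) ξ := fun ξ => leftWeight_mul_a_last hk hw e ξ
  have hw0 : ∀ (N : ℕ) (ζ : Fin N → Y), 0 ≤ w N ζ := fun N ζ => w_nonneg hw hK0 N ζ
  set Z : ℝ := ∫ ξ', w e ξ' ∂(Measure.pi fun _ : Fin e => ρ) with hZdef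
  set I : ℝ := ∫ ξ, Gl ξ ^ 2 * w (e + 1) ξ ∂(Measure.pi fun _ : Fin (e + 1) => ρ) with hIdef
  have hZ0 : 0 ≤ Z := integral_nonneg fun ξ' => hw0 e ξ'
  have hI0 : 0 ≤ I := integral_nonneg fun ξ => mul_nonneg (sq_nonneg _) (hw0 _ ξ)
  -- the integrand of `Ĝ`
  set Φ : (Fin (e + 1) → Y) → ℝ := fun ξ => Gl ξ * L ξ with hΦdef
  have hΦm : Measurable Φ := hGl.mul hLm
  have hĜ' : ∀ x, Ĝ x = ∫ ξ', Φ (Fin.snoc ξ' x) ∂(Measure.pi fun _ : Fin e => ρ) := fun x => by rw [hĜ]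
  have hsm : Measurable fun p : Y × (Fin e → Y) => (Fin.snoc p.2 p.1 : Fin (e + 1) → Y) :=
    measurable_snoc e
  -- measurability of `Ĝ`
  have hĜm : StronglyMeasurable Ĝ := by
    have h1 : Ĝ = fun x => ∫ ξ', (fun p : Y × (Fin e → Y) => Φ (Fin.snoc p.2 p.1)) (x, ξ') ∂(Measure.pi fun _ : Fin e => ρ) :=
      funext fun x => hĜ' x
    rw [h1]
    exact (hΦm.comp hsm).stronglyMeasurable.integral_prod_right'
  -- pointwise Cauchy–Schwarz
  have hpt : ∀ x, ‖Ĝ x‖ₑ ^ 2 ≤ ENNReal.ofReal Z *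
      ∫⁻ ξ', ENNReal.ofReal (a x * L (Fin.snoc ξ' x) * Gl (Fin.snoc ξ' x) ^ 2) ∂(Measure.pi fun _ : Fin e => ρ) := by
    intro x
    set f : (Fin e → Y) → ℝ≥0∞ := fun ξ' => ENNReal.ofReal (Real.sqrt (L (Fin.snoc ξ' x))) with hf
    set g : (Fin e → Y) → ℝ≥0∞ := fun ξ' =>
      ENNReal.ofReal (Real.sqrt (L (Fin.snoc ξ' x)) * |Gl (Fin.snoc ξ' x)|) with hg
    have hsx : Measurable fun ξ' : Fin e → Y => (Fin.snoc ξ' x : Fin (e + 1) → Y) :=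
      hsm.comp (measurable_const.prodMk measurable_id)
    have hfm : AEMeasurable f (Measure.pi fun _ : Fin e => ρ) :=
      ((hLm.comp hsx).sqrt.ennreal_ofReal).aemeasurable
    have hgm : AEMeasurable g (Measure.pi fun _ : Fin e => ρ) :=
      (((hLm.comp hsx).sqrt.mul (continuous_abs.measurable.comp (hGl.comp hsx))).ennreal_ofReal).aemeasurable
    have h1 : ‖Ĝ x‖ₑ ≤ ∫⁻ ξ', (f * g) ξ' ∂(Measure.pi fun _ : Fin e => ρ) := by
      rw [hĜ']
      refine (enorm_integral_le_lintegral_enorm _).trans (lintegral_mono fun ξ' => le_of_eq ?_)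
      rw [Pi.mul_apply, hf, hg]
      dsimp only
      rw [← ENNReal.ofReal_mul (Real.sqrt_nonneg _), ← mul_assoc, Real.mul_self_sqrt (hL0 _),
        Real.enorm_eq_ofReal_abs, hΦdef]
      dsimp only
      rw [abs_mul, abs_of_nonneg (hL0 _), mul_comm]
    have h2 : ∫⁻ ξ', (f * g) ξ' ∂(Measure.pi fun _ : Fin e => ρ) ≤ (∫⁻ ξ', f ξ' ^ 2 ∂(Measure.pi fun _ : Fin e => ρ)) ^ (1 / 2 : ℝ) * (∫⁻ ξ', g ξ' ^ 2 ∂(Measure.pi fun _ : Fin e => ρ)) ^ (1 / 2 : ℝ) := by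
      have hcs := ENNReal.lintegral_mul_le_Lp_mul_Lq (Measure.pi fun _ : Fin e => ρ) Real.HolderConjugate.two_two hfm hgm
      simp only [ENNReal.rpow_two] at hcs
      exact hcs
    have hf2 : ∀ ξ', f ξ' ^ 2 = ENNReal.ofReal (L (Fin.snoc ξ' x)) := fun ξ' => by
      rw [hf]
      dsimp only
      rw [← ENNReal.ofReal_pow (Real.sqrt_nonneg _), Real.sq_sqrt (hL0 _)]
    have hg2 : ∀ ξ', g ξ' ^ 2 = ENNReal.ofReal (L (Fin.snoc ξ' x) * Gl (Fin.snoc ξ' x) ^ 2) := fun ξ' => by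
      rw [hg]
      dsimp only
      rw [← ENNReal.ofReal_pow (mul_nonneg (Real.sqrt_nonneg _) (abs_nonneg _)), mul_pow,
        Real.sq_sqrt (hL0 _), sq_abs]
    simp_rw [hf2, hg2] at h2
    -- square
    have h3 : ‖Ĝ x‖ₑ ^ 2 ≤ (∫⁻ ξ', ENNReal.ofReal (L (Fin.snoc ξ' x)) ∂(Measure.pi fun _ : Fin e => ρ)) *
        ∫⁻ ξ', ENNReal.ofReal (L (Fin.snoc ξ' x) * Gl (Fin.snoc ξ' x) ^ 2) ∂(Measure.pi fun _ : Fin e => ρ) := by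
      calc ‖Ĝ x‖ₑ ^ 2 ≤ ((∫⁻ ξ', ENNReal.ofReal (L (Fin.snoc ξ' x)) ∂(Measure.pi fun _ : Fin e => ρ)) ^ (1 / 2 : ℝ) *
            (∫⁻ ξ', ENNReal.ofReal (L (Fin.snoc ξ' x) * Gl (Fin.snoc ξ' x) ^ 2) ∂(Measure.pi fun _ : Fin e => ρ)) ^ (1 / 2 : ℝ)) ^ 2 :=
            pow_le_pow_left' (h1.trans h2) 2
        _ = _ := by
            rw [mul_pow, ← ENNReal.rpow_two, ← ENNReal.rpow_two, ← ENNReal.rpow_mul, ← ENNReal.rpow_mul]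
            norm_num
    -- the first factor is at most `a x · Z`
    have h4 : ∫⁻ ξ', ENNReal.ofReal (L (Fin.snoc ξ' x)) ∂(Measure.pi fun _ : Fin e => ρ) ≤ ENNReal.ofReal (a x) * ENNReal.ofReal Z := by
      calc ∫⁻ ξ', ENNReal.ofReal (L (Fin.snoc ξ' x)) ∂(Measure.pi fun _ : Fin e => ρ)
          ≤ ∫⁻ ξ', ENNReal.ofReal (a x) * ENNReal.ofReal (w e ξ') ∂(Measure.pi fun _ : Fin e => ρ) := by
            refine lintegral_mono fun ξ' => ?_
            rw [← ENNReal.ofReal_mul (ha0 x).le]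
            exact ENNReal.ofReal_le_ofReal (hLsnoc ξ' x)
        _ = ENNReal.ofReal (a x) * ∫⁻ ξ', ENNReal.ofReal (w e ξ') ∂(Measure.pi fun _ : Fin e => ρ) :=
            lintegral_const_mul' _ _ ENNReal.ofReal_ne_top
        _ = ENNReal.ofReal (a x) * ENNReal.ofReal Z := by
            rw [hZdef, ofReal_integral_eq_lintegral_ofReal hZ (ae_of_all _ fun ξ' => hw0 e ξ')]
    calc ‖Ĝ x‖ₑ ^ 2 ≤ (ENNReal.ofReal (a x) * ENNReal.ofReal Z) *
          ∫⁻ ξ', ENNReal.ofReal (L (Fin.snoc ξ' x) * Gl (Fin.snoc ξ' x) ^ 2) ∂(Measure.pi fun _ : Fin e => ρ) :=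
          h3.trans (mul_le_mul_left h4 _)
      _ = ENNReal.ofReal Z * (ENNReal.ofReal (a x) *
          ∫⁻ ξ', ENNReal.ofReal (L (Fin.snoc ξ' x) * Gl (Fin.snoc ξ' x) ^ 2) ∂(Measure.pi fun _ : Fin e => ρ)) := by ring
      _ = ENNReal.ofReal Z * ∫⁻ ξ', ENNReal.ofReal (a x * L (Fin.snoc ξ' x) * Gl (Fin.snoc ξ' x) ^ 2) ∂(Measure.pi fun _ : Fin e => ρ) := by
          rw [← lintegral_const_mul' _ _ ENNReal.ofReal_ne_top]
          congr 1
          refine lintegral_congr fun ξ' => ?_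
          rw [← ENNReal.ofReal_mul (ha0 x).le]
          congr 1
          ring
  -- integrate in `x` and undo the freezing
  have hFm : Measurable fun ξ : Fin (e + 1) → Y =>
      ENNReal.ofReal (a (ξ (Fin.last e)) * L ξ * Gl ξ ^ 2) :=
    (((ham.comp (measurable_pi_apply _)).mul hLm).mul (hGl.pow_const 2)).ennreal_ofReal
  have htot : ∫⁻ x, ‖Ĝ x‖ₑ ^ 2 ∂ρ ≤ ENNReal.ofReal (Z * I) := by
    calc ∫⁻ x, ‖Ĝ x‖ₑ ^ 2 ∂ρ
        ≤ ∫⁻ x, ENNReal.ofReal Z *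
            ∫⁻ ξ', ENNReal.ofReal (a x * L (Fin.snoc ξ' x) * Gl (Fin.snoc ξ' x) ^ 2) ∂(Measure.pi fun _ : Fin e => ρ) ∂ρ :=
          lintegral_mono fun x => hpt x
      _ = ENNReal.ofReal Z *
            ∫⁻ x, ∫⁻ ξ', ENNReal.ofReal (a x * L (Fin.snoc ξ' x) * Gl (Fin.snoc ξ' x) ^ 2) ∂(Measure.pi fun _ : Fin e => ρ) ∂ρ :=
          lintegral_const_mul' _ _ ENNReal.ofReal_ne_top
      _ = ENNReal.ofReal Z * ∫⁻ ξ, ENNReal.ofReal (a (ξ (Fin.last e)) * L ξ * Gl ξ ^ 2) ∂(Measure.pi fun _ : Fin (e + 1) => ρ) := by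
          rw [lintegral_pi_succ_eq_snoc ρ e hFm]
          simp only [Fin.snoc_last]
      _ = ENNReal.ofReal Z * ∫⁻ ξ, ENNReal.ofReal (Gl ξ ^ 2 * w (e + 1) ξ) ∂(Measure.pi fun _ : Fin (e + 1) => ρ) := by
          congr 1
          refine lintegral_congr fun ξ => ?_
          rw [← hLa ξ]
          congr 1
          ring
      _ = ENNReal.ofReal Z * ENNReal.ofReal I := by
          rw [hIdef, ofReal_integral_eq_lintegral_ofReal hI
            (ae_of_all _ fun ξ => mul_nonneg (sq_nonneg _) (hw0 _ ξ))]
      _ = ENNReal.ofReal (Z * I) := (ENNReal.ofReal_mul hZ0).symm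
  -- conclusions
  have hsq : ∀ x, ENNReal.ofReal (Ĝ x ^ 2) = ‖Ĝ x‖ₑ ^ 2 := fun x => by
    rw [← sq_abs, ENNReal.ofReal_pow (abs_nonneg _), ← Real.enorm_eq_ofReal_abs]
  have hint2 : Integrable (fun x => Ĝ x ^ 2) ρ := by
    refine ⟨(hĜm.aestronglyMeasurable).pow 2, ?_⟩
    rw [hasFiniteIntegral_iff_enorm]
    simp_rw [enorm_pow]
    exact htot.trans_lt ENNReal.ofReal_lt_top
  refine ⟨(memLp_two_iff_integrable_sq hĜm.aestronglyMeasurable).2 hint2, ?_⟩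
  rw [integral_eq_lintegral_of_nonneg_ae (ae_of_all _ fun x => sq_nonneg (Ĝ x))
    ((hĜm.aestronglyMeasurable).pow 2)]
  simp_rw [hsq]
  exact ENNReal.toReal_le_of_le_ofReal (mul_nonneg hZ0 hI0) htot

end Weight


/-- **Headline (registered helper stub).** Gluing two blocks of one-site phase spaces `ℝ × ℝ` along
`Fin.append` is a measure-preserving equivalence `Ω_l × Ω_m ≃ Ω_{l+m}` for the product a priori
measures — the Fubini backbone of the block split `integral_mul_w_split`. -/
theorem append_measurePreserving_phaseBlocks :
    ∀ (ρ : Measure (ℝ × ℝ)) [SigmaFinite ρ] (l m : ℕ),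
      ∃ e : (Fin l → ℝ × ℝ) × (Fin m → ℝ × ℝ) ≃ᵐ (Fin (l + m) → ℝ × ℝ),
        (∀ p, e p = Fin.append p.1 p.2) ∧
        MeasurePreserving e ((Measure.pi fun _ : Fin l => ρ).prod (Measure.pi fun _ : Fin m => ρ))
          (Measure.pi fun _ : Fin (l + m) => ρ) := by
  intro ρ _ l m
  exact exists_measurableEquiv_append ρ l m

end Summit.AtomisticToContinuum.FouriersLaw.Theorems.LocalOhmBirth.TermDecay

end
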